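import Literature.NumberTheory.LFunctions.Zhang2022.Section3EulerFactors
import HarnessLib

/-!
# Zhang (2022) §3, the four-factor variant: `∑ ν(n)²τ₂(n) n^{-s} = ζ(s)⁴ L(s,χ)⁴ φ♭(s)` with `φ♭`
# holomorphic and bounded on `re s > 1/2`

Topic `Literature/NumberTheory/LFunctions/Zhang2022` (Landau–Siegel autopsy tree; verdict-neutral
inventory). Y. Zhang, *Discrete mean estimates and the Landau–Siegel zero*, arXiv:2211.02515v1 —
**an unrefereed manuscript, a claimed result under adjudication** — §3: the sketched proof of
Lemma 3.2 writes the generating function of `ν²τ₂²` as `ζ⁸L⁸φ*` "analytic for `σ > 1/2`"; the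
autopsy cell's input-free variant (ALT-1.md §4, family A11, "Lemma 3.2♭") uses instead the
generating function of `ν(n)²τ₂(n)` (`ν = 1 ∗ χ`, `τ₂ = d`), which is `ζ(s)⁴L(s,χ)⁴φ♭(s)`.
The LOCAL factors of `φ♭` were computed in `Section3EulerFactors.lean`
(`hasSum_nu_sq_tau_split|inert|ramified`: `φ♭ₚ(z) = 1 − 9z² + 16z³ − 9z⁴ + z⁶`, `1 − z² − z⁴ + z⁶`,
`(1 − z)²` for `χ(p) = 1, −1, 0`, `z = p^{-s}`; `‖φ♭ₚ − 1‖ ≤ 35‖z‖²` off `D`), which left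
"`TODO(holomorphy)`: the standard Weierstrass argument". This file discharges it. Everything is
PROVED (two definitions with bodies: the local factor `factor w z` and
`phiFlat χ s = ∏' p, factor (χ p) (p^{-s})`; no named fact):

* `LSeries_nu_sq_tau_eq` — for `χ` mod `D ≥ 1` with `χ² = 1` and `re s > 1`:
  **`∑_{n≥1} ν(n)² d(n) n^{-s} = ζ(s)⁴ · L(s,χ)⁴ · φ♭(s)`** (Euler products: Mathlib's
  `EulerProduct.eulerProduct_hasProd` for the multiplicative `n ↦ ν(n)²d(n)n^{-s}`,
  `riemannZeta_eulerProduct_hasProd`, `DirichletCharacter.LSeries_eulerProduct_hasProd`);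
* `hasProd_factor` — for `re s > 1/2` the product converges (unconditionally) to `φ♭(s)`;
* `differentiableOn_phiFlat` — **`φ♭` is holomorphic on `re s > 1/2`** (Weierstrass `M`-test:
  Mathlib's `Summable.hasProdLocallyUniformlyOn_one_add` + `TendstoLocallyUniformlyOn.differentiableOn`
  on each half-plane `re s > σ₀ > 1/2`, with `M_p = (35 + 3D^{σ₀}) p^{-2σ₀}`);
* `norm_phiFlat_le` — for `1/2 < σ₀ ≤ re s`: `‖φ♭(s)‖ ≤ 4^{ω(D)} exp(35 ∑_p p^{-2σ₀})`
  (ramified factors `‖(1 − p^{-s})²‖ ≤ 4`); `norm_phiFlat_le_of_re_cpow_nonneg` — if moreover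
  `re p^{-s} ≥ 0` for every `p ∣ D` (e.g. `|im s| log p ≤ π/2`), then
  `‖φ♭(s)‖ ≤ exp(35 ∑_p p^{-2σ₀})`, an ABSOLUTE constant (`‖1 − z‖² ≤ 1 + ‖z‖²` when `re z ≥ 0`) —
  the form needed on the residue circle `|s − 1| = 𝓛^{-2024}` of the cell's Lemma 3.2♭ count.

With these, the cell's Lemma 3.2♭ (`∑_{D⁴<n≤D⁸} ν²τ₂/n ≪ 𝓛^{-2015}` under (A)) is reduced to the
contour bookkeeping already carried out for Lemma 3.1 in `Section3Lemma31.lean` (pole of order 4 at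
`s = 0`: the tree's `Literature.Analysis.Complex.integral_vertical_sub_eq_sum_of_poles`). No
statement about the manuscript's Theorems 1–2 is made or implied.

## References

* Y. Zhang, arXiv:2211.02515 (2022), §3, Lemmas 3.1–3.2. [cite: Zhang2022LandauSiegel, §3, Lemma 3.2]
* E. C. Titchmarsh, *The Theory of the Riemann Zeta-Function*, 2nd ed. (1986), §1.1 (Euler
  products; the Weierstrass argument). [cite: Titchmarsh1986, §1.1]
-/

noncomputable section

open Complex Finset Filter Topology Set Real
open scoped LSeries.notation

namespace Literature.NumberTheory.LFunctions.Zhang2022.PhiFlat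

open Literature.NumberTheory.LFunctions.Zhang2022.Section3EulerFactors
  (hasSum_nu_sq_tau_split hasSum_nu_sq_tau_inert hasSum_nu_sq_tau_ramified
   norm_phiFlat_split_sub_one_le norm_phiFlat_inert_sub_one_le summable_primes_norm_cpow_neg_sq
   norm_prime_cpow_neg_lt_one)

/-! ### The local factor `φ♭ₚ` -/

/-- The local factor `φ♭ₚ(z)` as a function of the splitting type `w = χ(p) ∈ {1, −1, 0}` and
`z = p^{-s}`: `1 − 9z² + 16z³ − 9z⁴ + z⁶` (split), `1 − z² − z⁴ + z⁶` (inert), `(1 − z)²` (ramified).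
[folklore] -/
def factor (w z : ℂ) : ℂ :=
  if w = 1 then 1 - 9 * z ^ 2 + 16 * z ^ 3 - 9 * z ^ 4 + z ^ 6
  else if w = -1 then 1 - z ^ 2 - z ^ 4 + z ^ 6 else (1 - z) ^ 2

/-- Split value. [folklore] -/
theorem factor_one (z : ℂ) : factor 1 z = 1 - 9 * z ^ 2 + 16 * z ^ 3 - 9 * z ^ 4 + z ^ 6 := by
  simp [factor]

/-- Inert value. [folklore] -/
theorem factor_neg_one (z : ℂ) : factor (-1) z = 1 - z ^ 2 - z ^ 4 + z ^ 6 := by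
  have h : (-1 : ℂ) ≠ 1 := by norm_num
  simp [factor, h]

/-- Ramified value. [folklore] -/
theorem factor_zero (z : ℂ) : factor 0 z = (1 - z) ^ 2 := by
  simp [factor]

/-- **The local identity**: for `w ∈ {0, 1, −1}` and `‖z‖ < 1`,
`∑_m ν(pᵐ)²τ₂(pᵐ) zᵐ = (1−z)^{−4}(1−wz)^{−4} · φ♭ₚ(z)` with `ν(pᵐ) = 1 + w + ⋯ + wᵐ`
(`Section3EulerFactors.hasSum_nu_sq_tau_*`). [folklore] -/
theorem hasSum_local {w z : ℂ} (hw : w = 0 ∨ w = 1 ∨ w = -1) (hz : ‖z‖ < 1) :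
    HasSum (fun m : ℕ => geomPartialSum w m ^ 2 * ((m : ℂ) + 1) * z ^ m)
      (((1 - z)⁻¹) ^ 4 * ((1 - w * z)⁻¹) ^ 4 * factor w z) := by
  have hz1 : (1 : ℂ) - z ≠ 0 := by
    intro h; have : ‖z‖ = 1 := by rw [← sub_eq_zero.1 h, norm_one]
    linarith
  have hz2 : (1 : ℂ) + z ≠ 0 := by
    intro h
    have : z = -1 := by linear_combination h
    rw [this, norm_neg, norm_one] at hz; exact lt_irrefl _ hz
  rcases hw with rfl | rfl | rfl
  · have h := hasSum_nu_sq_tau_ramified hz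
    rw [factor_zero]
    convert h using 1
    rw [zero_mul, sub_zero, inv_one, one_pow, mul_one]
    field_simp
  · have h := hasSum_nu_sq_tau_split hz
    rw [factor_one]
    convert h using 1
    rw [one_mul]
    field_simp
  · have h := hasSum_nu_sq_tau_inert hz
    rw [factor_neg_one]
    convert h using 1
    rw [neg_one_mul, sub_neg_eq_add]
    field_simp

/-- `‖φ♭ₚ(z) − 1‖ ≤ 35‖z‖²` for `w = ±1` and `‖z‖ ≤ 1`. [folklore] -/
theorem norm_factor_sub_one_le_of_unit {w z : ℂ} (hw : w = 1 ∨ w = -1) (hz : ‖z‖ ≤ 1) :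
    ‖factor w z - 1‖ ≤ 35 * ‖z‖ ^ 2 := by
  rcases hw with rfl | rfl
  · rw [factor_one]; exact norm_phiFlat_split_sub_one_le hz
  · rw [factor_neg_one]
    exact (norm_phiFlat_inert_sub_one_le hz).trans (by gcongr; norm_num)

/-- `‖φ♭ₚ(z) − 1‖ ≤ 3‖z‖` for the ramified factor, `‖z‖ ≤ 1`. [folklore] -/
theorem norm_factor_zero_sub_one_le {z : ℂ} (hz : ‖z‖ ≤ 1) : ‖factor 0 z - 1‖ ≤ 3 * ‖z‖ := by
  rw [factor_zero, show ((1 : ℂ) - z) ^ 2 - 1 = z * (z - 2) by ring, norm_mul]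
  have : ‖z - 2‖ ≤ 3 := by
    have h := norm_sub_le z 2
    have : ‖(2 : ℂ)‖ = 2 := by norm_num
    linarith
  calc ‖z‖ * ‖z - 2‖ ≤ ‖z‖ * 3 := by gcongr
    _ = 3 * ‖z‖ := by ring

/-- `‖φ♭ₚ(z)‖ ≤ 4` for the ramified factor, `‖z‖ ≤ 1`. [folklore] -/
theorem norm_factor_zero_le {z : ℂ} (hz : ‖z‖ ≤ 1) : ‖factor 0 z‖ ≤ 4 := by
  rw [factor_zero, norm_pow]
  have : ‖(1 : ℂ) - z‖ ≤ 2 := by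
    have h := norm_sub_le (1 : ℂ) z; rw [norm_one] at h; linarith
  nlinarith [norm_nonneg ((1 : ℂ) - z)]

/-- `‖φ♭ₚ(z)‖ ≤ 1 + ‖z‖²` for the ramified factor when `re z ≥ 0` (and `‖z‖ ≤ 1`):
`‖1 − z‖² = 1 − 2 re z + ‖z‖²`. [folklore] -/
theorem norm_factor_zero_le_of_re_nonneg {z : ℂ} (hz : 0 ≤ z.re) :
    ‖factor 0 z‖ ≤ 1 + ‖z‖ ^ 2 := by
  rw [factor_zero, norm_pow, Complex.sq_norm, Complex.sq_norm, Complex.normSq_apply,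
    Complex.normSq_apply]
  simp only [sub_re, one_re, sub_im, one_im, zero_sub, mul_neg, neg_mul, neg_neg]
  nlinarith

/-- `z ↦ φ♭ₚ(z)` is a polynomial, hence entire (for each fixed `w`). [folklore] -/
theorem differentiable_factor (w : ℂ) : Differentiable ℂ (factor w) := by
  unfold factor
  split_ifs <;> fun_prop

/-! ### Values of a quadratic character -/

section Character

variable {D : ℕ} (χ : DirichletCharacter ℂ D)

/-- A quadratic character takes the values `0, 1, −1`. [folklore] -/
theorem apply_eq_zero_or_one_or_neg_one (hχ : χ ^ 2 = 1) (a : ZMod D) :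
    χ a = 0 ∨ χ a = 1 ∨ χ a = -1 := by
  by_cases ha : IsUnit a
  · have h2 : (χ a) ^ 2 = 1 := by
      rw [← MulChar.pow_apply' χ two_ne_zero, hχ, MulChar.one_apply ha]
    exact Or.inr (sq_eq_one_iff.1 h2)
  · exact Or.inl (χ.map_nonunit ha)

/-- For a prime `p`: `χ(p) = 0 ↔ p ∣ D`. [folklore] -/
theorem apply_prime_eq_zero_iff {p : ℕ} (hp : p.Prime) : χ (p : ZMod D) = 0 ↔ p ∣ D := by
  constructor
  · intro h
    by_contra hnd
    have hu : IsUnit (p : ZMod D) :=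
      (ZMod.isUnit_iff_coprime p D).2 (hp.coprime_iff_not_dvd.2 hnd)
    exact (hu.map χ).ne_zero h
  · intro h
    exact χ.map_nonunit
      (mt (ZMod.isUnit_iff_coprime p D).1 fun hc => hp.coprime_iff_not_dvd.1 hc h)

end Character

/-! ### The Dirichlet series of `ν²τ₂` and its Euler product -/

section Series

variable {D : ℕ} (χ : DirichletCharacter ℂ D)

/-- The general term `ν(n)² d(n) n^{-s}`. [folklore] -/
def term (s : ℂ) (n : ℕ) : ℂ := divisorSumChar χ n ^ 2 * (n.divisors.card : ℂ) * (n : ℂ) ^ (-s)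

/-- The `L`-series of `ν²d` is `∑' term`. [folklore] -/
theorem LSeries_eq_tsum (s : ℂ) :
    L (fun n => divisorSumChar χ n ^ 2 * (n.divisors.card : ℂ)) s = ∑' n, term χ s n := by
  rw [LSeries]
  refine tsum_congr fun n => ?_
  rw [LSeries.term_def₀ (by simp), term]

/-- `term` is multiplicative on coprime arguments. [folklore] -/
theorem term_mul_of_coprime (s : ℂ) {m n : ℕ} (hmn : m.Coprime n) :
    term χ s (m * n) = term χ s m * term χ s n := by
  simp only [term]
  rw [divisorSumChar_mul_of_coprime χ hmn, Nat.Coprime.card_divisors_mul hmn, Nat.cast_mul,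
    Nat.cast_mul, natCast_mul_natCast_cpow]
  ring

/-- `term 1 = 1`. [folklore] -/
theorem term_one (s : ℂ) : term χ s 1 = 1 := by simp [term]

/-- `term 0 = 0`. [folklore] -/
theorem term_zero (s : ℂ) : term χ s 0 = 0 := by simp [term]

/-- On prime powers: `term(pᵉ) = ν(pᵉ)² (e+1) (p^{-s})ᵉ`. [folklore] -/
theorem term_prime_pow (s : ℂ) {p : ℕ} (hp : p.Prime) (e : ℕ) :
    term χ s (p ^ e) = geomPartialSum (χ (p : ZMod D)) e ^ 2 * ((e : ℂ) + 1) *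
      (((p : ℕ) : ℂ) ^ (-s)) ^ e := by
  rw [term, divisorSumChar_prime_pow χ hp, ← ArithmeticFunction.sigma_zero_apply,
    ArithmeticFunction.sigma_zero_apply_prime_pow hp, Nat.cast_pow, ← natCast_cpow_natCast_mul,
    cpow_nat_mul]
  push_cast
  ring

/-- Absolute convergence for `re s > 1` (`|ν(n)²d(n)| ≤ d(n)³ ≤ C³ n^{3η}`, `η = (σ−1)/6`).
[folklore] -/
theorem summable_norm_term {s : ℂ} (hs : 1 < s.re) : Summable fun n => ‖term χ s n‖ := by
  obtain ⟨C, hC1, hC⟩ :=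
    Literature.NumberTheory.Sieve.exists_card_divisors_le_mul_rpow' (ε := (s.re - 1) / 6) (by linarith)
  have hsum : Summable fun n : ℕ => C ^ 3 * (n : ℝ) ^ (-(s.re + 1) / 2) := by
    refine (Real.summable_nat_rpow.2 ?_).mul_left _
    linarith
  refine Summable.of_nonneg_of_le (fun n => norm_nonneg _) (fun n => ?_) hsum
  rcases Nat.eq_zero_or_pos n with rfl | hn
  · rw [term_zero, norm_zero]; positivity
  · have hn' : (0 : ℝ) < n := by exact_mod_cast hn
    rw [term, norm_mul, norm_mul, norm_pow, norm_natCast_cpow_of_pos hn, neg_re, Complex.norm_natCast]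
    have hν : ‖divisorSumChar χ n‖ ≤ C * (n : ℝ) ^ ((s.re - 1) / 6) :=
      (norm_divisorSumChar_le χ n).trans (hC n)
    have hτ : (n.divisors.card : ℝ) ≤ C * (n : ℝ) ^ ((s.re - 1) / 6) := hC n
    have h0 : 0 ≤ ‖divisorSumChar χ n‖ := norm_nonneg _
    calc ‖divisorSumChar χ n‖ ^ 2 * (n.divisors.card : ℝ) * (n : ℝ) ^ (-s.re)
        ≤ (C * (n : ℝ) ^ ((s.re - 1) / 6)) ^ 2 * (C * (n : ℝ) ^ ((s.re - 1) / 6)) *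
            (n : ℝ) ^ (-s.re) := by gcongr
      _ = C ^ 3 * ((n : ℝ) ^ ((s.re - 1) / 6) * (n : ℝ) ^ ((s.re - 1) / 6) *
            (n : ℝ) ^ ((s.re - 1) / 6) * (n : ℝ) ^ (-s.re)) := by ring
      _ = C ^ 3 * (n : ℝ) ^ (-(s.re + 1) / 2) := by
          rw [← Real.rpow_add hn', ← Real.rpow_add hn', ← Real.rpow_add hn']; ring_nf

/-- **Euler product for `∑ ν(n)²d(n) n^{-s}`** (`re s > 1`). [folklore] -/
theorem hasProd_term {s : ℂ} (hs : 1 < s.re) :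
    HasProd (fun p : Nat.Primes => ∑' e, term χ s ((p : ℕ) ^ e)) (∑' n, term χ s n) :=
  EulerProduct.eulerProduct_hasProd (f := term χ s) (term_one χ s)
    (fun hmn => term_mul_of_coprime χ s hmn) (summable_norm_term χ hs) (term_zero χ s)

/-- The local Euler factor in closed form (`χ² = 1`, `re s > 0`):
`∑_e term(pᵉ) = (1 − p^{-s})^{-4} (1 − χ(p)p^{-s})^{-4} φ♭ₚ(p^{-s})`. [folklore] -/
theorem tsum_term_prime_pow (hχ : χ ^ 2 = 1) {s : ℂ} (hs : 0 < s.re) (p : Nat.Primes) :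
    ∑' e, term χ s ((p : ℕ) ^ e) =
      ((1 - ((p : ℕ) : ℂ) ^ (-s))⁻¹) ^ 4 * ((1 - χ ((p : ℕ) : ZMod D) * ((p : ℕ) : ℂ) ^ (-s))⁻¹) ^ 4 *
        factor (χ ((p : ℕ) : ZMod D)) (((p : ℕ) : ℂ) ^ (-s)) := by
  have hz := norm_prime_cpow_neg_lt_one hs p
  have hw := apply_eq_zero_or_one_or_neg_one χ hχ ((p : ℕ) : ZMod D)
  have h := hasSum_local hw hz
  rw [← h.tsum_eq]
  exact tsum_congr fun e => term_prime_pow χ s p.prop e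

end Series

/-! ### `φ♭` as a function; convergence for `re s > 1/2` -/

section PhiFlatDef

variable {D : ℕ} (χ : DirichletCharacter ℂ D)

/-- **`φ♭(s) = ∏_p φ♭ₚ(p^{-s})`** (an unconditionally convergent product for `re s > 1/2`).
[cite: Zhang2022LandauSiegel, §3, Lemma 3.2 sketch (four-factor variant)] -/
def phiFlat (s : ℂ) : ℂ := ∏' p : Nat.Primes, factor (χ ((p : ℕ) : ZMod D)) (((p : ℕ) : ℂ) ^ (-s))

/-- The uniform majorant: for `σ₀ ≤ re s`, `‖φ♭ₚ(p^{-s}) − 1‖ ≤ (35 + 3 D^{σ₀}) p^{-2σ₀}`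
(`χ² = 1`, `D ≥ 1`; for `p ∣ D` the bound `3p^{-σ} ≤ 3 D^{σ₀} p^{-2σ₀}` is used). [folklore] -/
theorem norm_factor_sub_one_le [NeZero D] (hχ : χ ^ 2 = 1) {σ₀ : ℝ} (hσ₀ : 0 < σ₀) {s : ℂ}
    (hs : σ₀ ≤ s.re) (p : Nat.Primes) :
    ‖factor (χ ((p : ℕ) : ZMod D)) (((p : ℕ) : ℂ) ^ (-s)) - 1‖ ≤
      (35 + 3 * (D : ℝ) ^ σ₀) * ((p : ℕ) : ℝ) ^ (-(2 * σ₀)) := by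
  have hp0 : (0 : ℝ) < (p : ℕ) := by exact_mod_cast p.prop.pos
  have hp1 : (1 : ℝ) ≤ (p : ℕ) := by exact_mod_cast p.prop.one_lt.le
  have hz : ‖((p : ℕ) : ℂ) ^ (-s)‖ = ((p : ℕ) : ℝ) ^ (-s.re) := by
    rw [norm_natCast_cpow_of_pos p.prop.pos, neg_re]
  have hz1 : ‖((p : ℕ) : ℂ) ^ (-s)‖ ≤ 1 := (norm_prime_cpow_neg_lt_one (by linarith) p).le
  have hzσ : ‖((p : ℕ) : ℂ) ^ (-s)‖ ≤ ((p : ℕ) : ℝ) ^ (-σ₀) := by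
    rw [hz]; exact Real.rpow_le_rpow_of_exponent_le hp1 (by linarith)
  have hsq : ‖((p : ℕ) : ℂ) ^ (-s)‖ ^ 2 ≤ ((p : ℕ) : ℝ) ^ (-(2 * σ₀)) := by
    calc ‖((p : ℕ) : ℂ) ^ (-s)‖ ^ 2 ≤ (((p : ℕ) : ℝ) ^ (-σ₀)) ^ 2 :=
          pow_le_pow_left₀ (norm_nonneg _) hzσ 2
      _ = ((p : ℕ) : ℝ) ^ (-(2 * σ₀)) := by
          rw [← Real.rpow_natCast, ← Real.rpow_mul hp0.le]; ring_nf
  have hDσ : 0 ≤ (D : ℝ) ^ σ₀ := by positivity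
  have hpow0 : 0 ≤ ((p : ℕ) : ℝ) ^ (-(2 * σ₀)) := by positivity
  rcases apply_eq_zero_or_one_or_neg_one χ hχ ((p : ℕ) : ZMod D) with h0 | h1
  · -- ramified: `p ∣ D`, so `p ≤ D` and `p^{-σ₀} = p^{σ₀} p^{-2σ₀} ≤ D^{σ₀} p^{-2σ₀}`
    have hpD : (p : ℕ) ∣ D := (apply_prime_eq_zero_iff χ p.prop).1 h0
    have hpD' : ((p : ℕ) : ℝ) ≤ D := by exact_mod_cast Nat.le_of_dvd (Nat.pos_of_ne_zero (NeZero.ne D)) hpD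
    rw [h0]
    refine (norm_factor_zero_sub_one_le hz1).trans ?_
    have h1 : ((p : ℕ) : ℝ) ^ (-σ₀) = ((p : ℕ) : ℝ) ^ σ₀ * ((p : ℕ) : ℝ) ^ (-(2 * σ₀)) := by
      rw [← Real.rpow_add hp0]; ring_nf
    have h2 : ((p : ℕ) : ℝ) ^ σ₀ ≤ (D : ℝ) ^ σ₀ := Real.rpow_le_rpow hp0.le hpD' hσ₀.le
    calc 3 * ‖((p : ℕ) : ℂ) ^ (-s)‖ ≤ 3 * ((p : ℕ) : ℝ) ^ (-σ₀) := by linarith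
      _ = 3 * (((p : ℕ) : ℝ) ^ σ₀ * ((p : ℕ) : ℝ) ^ (-(2 * σ₀))) := by rw [h1]
      _ ≤ 3 * ((D : ℝ) ^ σ₀ * ((p : ℕ) : ℝ) ^ (-(2 * σ₀))) := by gcongr
      _ ≤ (35 + 3 * (D : ℝ) ^ σ₀) * ((p : ℕ) : ℝ) ^ (-(2 * σ₀)) := by nlinarith
  · refine (norm_factor_sub_one_le_of_unit h1 hz1).trans ?_
    calc 35 * ‖((p : ℕ) : ℂ) ^ (-s)‖ ^ 2 ≤ 35 * ((p : ℕ) : ℝ) ^ (-(2 * σ₀)) := by gcongr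
      _ ≤ (35 + 3 * (D : ℝ) ^ σ₀) * ((p : ℕ) : ℝ) ^ (-(2 * σ₀)) := by nlinarith

/-- `∑_p p^{-2σ₀} < ∞` for `σ₀ > 1/2`. [folklore] -/
theorem summable_primes_rpow {σ₀ : ℝ} (hσ₀ : 1 / 2 < σ₀) :
    Summable fun p : Nat.Primes => ((p : ℕ) : ℝ) ^ (-(2 * σ₀)) :=
  Nat.Primes.summable_rpow.mpr (by linarith)

/-- `∑_p ‖φ♭ₚ(p^{-s}) − 1‖ < ∞` for `re s > 1/2` (`χ² = 1`, `D ≥ 1`). [folklore] -/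
theorem summable_norm_factor_sub_one [NeZero D] (hχ : χ ^ 2 = 1) {s : ℂ} (hs : 1 / 2 < s.re) :
    Summable fun p : Nat.Primes => ‖factor (χ ((p : ℕ) : ZMod D)) (((p : ℕ) : ℂ) ^ (-s)) - 1‖ :=
  Summable.of_nonneg_of_le (fun p => norm_nonneg _)
    (fun p => norm_factor_sub_one_le χ hχ (σ₀ := s.re) (by linarith) le_rfl p)
    ((summable_primes_rpow hs).mul_left _)

/-- **Convergence**: for `re s > 1/2`, `∏_p φ♭ₚ(p^{-s})` converges to `φ♭(s)`. [folklore] -/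
theorem hasProd_factor [NeZero D] (hχ : χ ^ 2 = 1) {s : ℂ} (hs : 1 / 2 < s.re) :
    HasProd (fun p : Nat.Primes => factor (χ ((p : ℕ) : ZMod D)) (((p : ℕ) : ℂ) ^ (-s)))
      (phiFlat χ s) := by
  have hsum : Summable fun p : Nat.Primes =>
      factor (χ ((p : ℕ) : ZMod D)) (((p : ℕ) : ℂ) ^ (-s)) - 1 :=
    Summable.of_norm (summable_norm_factor_sub_one χ hχ hs)
  have hm : Multipliable fun p : Nat.Primes =>
      1 + (factor (χ ((p : ℕ) : ZMod D)) (((p : ℕ) : ℂ) ^ (-s)) - 1) :=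
    Complex.multipliable_one_add_of_summable hsum
  have hm' : Multipliable fun p : Nat.Primes => factor (χ ((p : ℕ) : ZMod D)) (((p : ℕ) : ℂ) ^ (-s)) :=
    hm.congr fun p => by ring
  exact hm'.hasProd

/-- **The global identity** (`χ² = 1`, `D ≥ 1`, `re s > 1`):
`∑_{n ≥ 1} ν(n)² d(n) n^{-s} = ζ(s)⁴ · L(s, χ)⁴ · φ♭(s)`.
[cite: Zhang2022LandauSiegel, §3, Lemma 3.2 sketch (four-factor variant)] -/
theorem LSeries_nu_sq_tau_eq [NeZero D] (hχ : χ ^ 2 = 1) {s : ℂ} (hs : 1 < s.re) :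
    L (fun n => divisorSumChar χ n ^ 2 * (n.divisors.card : ℂ)) s =
      riemannZeta s ^ 4 * (L ↗χ s) ^ 4 * phiFlat χ s := by
  have hζ := riemannZeta_eulerProduct_hasProd hs
  have hL := DirichletCharacter.LSeries_eulerProduct_hasProd χ hs
  have hφ := hasProd_factor χ hχ (s := s) (by linarith)
  have hν := hasProd_term χ hs
  have rhs := ((hζ.pow 4).mul (hL.pow 4)).mul hφ
  have hν' : HasProd (fun p : Nat.Primes =>
      ((1 - ((p : ℕ) : ℂ) ^ (-s))⁻¹) ^ 4 *
        ((1 - χ ((p : ℕ) : ZMod D) * ((p : ℕ) : ℂ) ^ (-s))⁻¹) ^ 4 *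
        factor (χ ((p : ℕ) : ZMod D)) (((p : ℕ) : ℂ) ^ (-s))) (∑' n, term χ s n) :=
    hν.congr_fun fun p => (tsum_term_prime_pow χ hχ (by linarith) p).symm
  rw [LSeries_eq_tsum]
  exact hν'.unique rhs

end PhiFlatDef

/-! ### Holomorphy on `re s > 1/2` (Weierstrass `M`-test) -/

section Holomorphy

variable {D : ℕ} (χ : DirichletCharacter ℂ D)

/-- Each `s ↦ φ♭ₚ(p^{-s})` is entire. [folklore] -/
theorem differentiable_factor_cpow (w : ℂ) (p : Nat.Primes) :
    Differentiable ℂ fun s : ℂ => factor w (((p : ℕ) : ℂ) ^ (-s)) :=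
  (differentiable_factor w).comp
    (differentiable_id.neg.const_cpow (Or.inl (by exact_mod_cast p.prop.ne_zero)))

/-- **`φ♭` is holomorphic on `re s > σ₀`** for every `σ₀ > 1/2` (`χ² = 1`, `D ≥ 1`): Mathlib's
`Summable.hasProdLocallyUniformlyOn_one_add` with the majorant `(35 + 3D^{σ₀}) p^{-2σ₀}` and
`TendstoLocallyUniformlyOn.differentiableOn`. [cite: Titchmarsh1986, §1.1] -/
theorem differentiableOn_phiFlat_of_lt [NeZero D] (hχ : χ ^ 2 = 1) {σ₀ : ℝ} (hσ₀ : 1 / 2 < σ₀) :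
    DifferentiableOn ℂ (phiFlat χ) {s : ℂ | σ₀ < s.re} := by
  set U : Set ℂ := {s : ℂ | σ₀ < s.re} with hU
  have hUo : IsOpen U := isOpen_lt continuous_const Complex.continuous_re
  set f : Nat.Primes → ℂ → ℂ := fun p s =>
    factor (χ ((p : ℕ) : ZMod D)) (((p : ℕ) : ℂ) ^ (-s)) - 1 with hf
  have hfd : ∀ p, Differentiable ℂ (f p) := fun p =>
    (differentiable_factor_cpow (χ ((p : ℕ) : ZMod D)) p).sub_const 1
  have hu : Summable fun p : Nat.Primes => (35 + 3 * (D : ℝ) ^ σ₀) * ((p : ℕ) : ℝ) ^ (-(2 * σ₀)) :=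
    (summable_primes_rpow hσ₀).mul_left _
  have hle : ∀ᶠ p in cofinite, ∀ s ∈ U, ‖f p s‖ ≤ (35 + 3 * (D : ℝ) ^ σ₀) * ((p : ℕ) : ℝ) ^ (-(2 * σ₀)) :=
    Eventually.of_forall fun p s hs =>
      norm_factor_sub_one_le χ hχ (σ₀ := σ₀) (by linarith) (le_of_lt hs) p
  have hprod := hu.hasProdLocallyUniformlyOn_one_add hUo hle fun p => (hfd p).continuous.continuousOn
  have hdiff : DifferentiableOn ℂ (fun s => ∏' p : Nat.Primes, (1 + f p s)) U := by
    refine (hasProdLocallyUniformlyOn_iff_tendstoLocallyUniformlyOn.mp hprod).differentiableOn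
      (Eventually.of_forall fun F => ?_) hUo
    exact (Differentiable.fun_finsetProd fun p _ => (hfd p).const_add 1).differentiableOn
  refine hdiff.congr fun s _ => ?_
  simp only [hf, add_sub_cancel, phiFlat]

/-- **`φ♭` is holomorphic on `re s > 1/2`.** [cite: Titchmarsh1986, §1.1] -/
theorem differentiableOn_phiFlat [NeZero D] (hχ : χ ^ 2 = 1) :
    DifferentiableOn ℂ (phiFlat χ) {s : ℂ | 1 / 2 < s.re} := by
  intro s hs
  have hs' : 1 / 2 < s.re := hs
  set σ₀ : ℝ := (1 / 2 + s.re) / 2 with hσ₀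
  have h1 : 1 / 2 < σ₀ := by rw [hσ₀]; linarith
  have h2 : σ₀ < s.re := by rw [hσ₀]; linarith
  have hd := differentiableOn_phiFlat_of_lt χ hχ h1
  have hopen : IsOpen {s : ℂ | σ₀ < s.re} := isOpen_lt continuous_const Complex.continuous_re
  exact (hd.differentiableAt (hopen.mem_nhds h2)).differentiableWithinAt

end Holomorphy

/-! ### Bounds -/

section Bounds

variable {D : ℕ} (χ : DirichletCharacter ℂ D)

/-- The number of ramified primes in a finite set of primes is at most `ω(D)` (`D ≥ 1`). [folklore] -/
theorem card_filter_dvd_le [NeZero D] (F : Finset Nat.Primes) :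
    (F.filter fun p : Nat.Primes => (p : ℕ) ∣ D).card ≤ D.primeFactors.card := by
  refine Finset.card_le_card_of_injOn (fun p : Nat.Primes => (p : ℕ)) (fun p hp => ?_)
    (fun p _ q _ h => Subtype.ext h)
  rw [Finset.mem_coe, Finset.mem_filter] at hp
  exact Nat.mem_primeFactors.2 ⟨p.prop, hp.2, NeZero.ne D⟩

/-- A finite partial product: for `1/2 < σ₀ ≤ re s`,
`‖∏_{p ∈ F} φ♭ₚ(p^{-s})‖ ≤ 4^{ω(D)} exp(35 ∑_p p^{-2σ₀})`. [folklore] -/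
theorem norm_prod_factor_le [NeZero D] (hχ : χ ^ 2 = 1) {σ₀ : ℝ} (hσ₀ : 1 / 2 < σ₀) {s : ℂ}
    (hs : σ₀ ≤ s.re) (F : Finset Nat.Primes) :
    ‖∏ p ∈ F, factor (χ ((p : ℕ) : ZMod D)) (((p : ℕ) : ℂ) ^ (-s))‖ ≤
      (4 : ℝ) ^ D.primeFactors.card *
        Real.exp (35 * ∑' p : Nat.Primes, ((p : ℕ) : ℝ) ^ (-(2 * σ₀))) := by
  classical
  have hsumm := summable_primes_rpow hσ₀
  rw [norm_prod, ← Finset.prod_filter_mul_prod_filter_not F (fun p : Nat.Primes => (p : ℕ) ∣ D)]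
  -- ramified part
  have hram : ∏ p ∈ F.filter (fun p : Nat.Primes => (p : ℕ) ∣ D),
      ‖factor (χ ((p : ℕ) : ZMod D)) (((p : ℕ) : ℂ) ^ (-s))‖ ≤ (4 : ℝ) ^ D.primeFactors.card := by
    calc ∏ p ∈ F.filter (fun p : Nat.Primes => (p : ℕ) ∣ D),
          ‖factor (χ ((p : ℕ) : ZMod D)) (((p : ℕ) : ℂ) ^ (-s))‖
        ≤ ∏ _p ∈ F.filter (fun p : Nat.Primes => (p : ℕ) ∣ D), (4 : ℝ) := by
          refine Finset.prod_le_prod (fun _ _ => norm_nonneg _) fun p hp => ?_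
          rw [Finset.mem_filter] at hp
          rw [(apply_prime_eq_zero_iff χ p.prop).2 hp.2]
          exact norm_factor_zero_le (norm_prime_cpow_neg_lt_one (by linarith) p).le
      _ = (4 : ℝ) ^ (F.filter fun p : Nat.Primes => (p : ℕ) ∣ D).card := by
          rw [Finset.prod_const]
      _ ≤ (4 : ℝ) ^ D.primeFactors.card := pow_le_pow_right₀ (by norm_num) (card_filter_dvd_le F)
  -- unramified part
  have hunr : ∏ p ∈ F.filter (fun p : Nat.Primes => ¬ (p : ℕ) ∣ D),
      ‖factor (χ ((p : ℕ) : ZMod D)) (((p : ℕ) : ℂ) ^ (-s))‖ ≤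
      Real.exp (35 * ∑' p : Nat.Primes, ((p : ℕ) : ℝ) ^ (-(2 * σ₀))) := by
    set G := F.filter (fun p : Nat.Primes => ¬ (p : ℕ) ∣ D) with hG
    have h1 : ∀ p ∈ G, ‖factor (χ ((p : ℕ) : ZMod D)) (((p : ℕ) : ℂ) ^ (-s))‖ ≤
        1 + 35 * ((p : ℕ) : ℝ) ^ (-(2 * σ₀)) := by
      intro p hp
      rw [hG, Finset.mem_filter] at hp
      have hw : χ ((p : ℕ) : ZMod D) = 1 ∨ χ ((p : ℕ) : ZMod D) = -1 := by
        rcases apply_eq_zero_or_one_or_neg_one χ hχ ((p : ℕ) : ZMod D) with h | h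
        · exact absurd ((apply_prime_eq_zero_iff χ p.prop).1 h) hp.2
        · exact h
      have hz1 : ‖((p : ℕ) : ℂ) ^ (-s)‖ ≤ 1 := (norm_prime_cpow_neg_lt_one (by linarith) p).le
      have hdev := norm_factor_sub_one_le_of_unit hw hz1
      have hp0 : (0 : ℝ) < (p : ℕ) := by exact_mod_cast p.prop.pos
      have hsq : ‖((p : ℕ) : ℂ) ^ (-s)‖ ^ 2 ≤ ((p : ℕ) : ℝ) ^ (-(2 * σ₀)) := by
        rw [norm_natCast_cpow_of_pos p.prop.pos, neg_re, ← Real.rpow_natCast,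
          ← Real.rpow_mul hp0.le]
        exact Real.rpow_le_rpow_of_exponent_le (by exact_mod_cast p.prop.one_lt.le)
          (by push_cast; linarith)
      calc ‖factor (χ ((p : ℕ) : ZMod D)) (((p : ℕ) : ℂ) ^ (-s))‖
          ≤ ‖(1 : ℂ)‖ + ‖factor (χ ((p : ℕ) : ZMod D)) (((p : ℕ) : ℂ) ^ (-s)) - 1‖ := by
            have := norm_add_le (1 : ℂ) (factor (χ ((p : ℕ) : ZMod D)) (((p : ℕ) : ℂ) ^ (-s)) - 1)
            rwa [add_sub_cancel] at this
        _ ≤ 1 + 35 * ((p : ℕ) : ℝ) ^ (-(2 * σ₀)) := by rw [norm_one]; linarith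
    calc ∏ p ∈ G, ‖factor (χ ((p : ℕ) : ZMod D)) (((p : ℕ) : ℂ) ^ (-s))‖
        ≤ ∏ p ∈ G, (1 + 35 * ((p : ℕ) : ℝ) ^ (-(2 * σ₀))) :=
          Finset.prod_le_prod (fun _ _ => norm_nonneg _) h1
      _ ≤ Real.exp (∑ p ∈ G, 35 * ((p : ℕ) : ℝ) ^ (-(2 * σ₀))) := by
          -- `∏ (1 + a_p) ≤ exp(∑ a_p)` (the tree's `Sieve.prod_one_add_le_exp_sum`, inlined)
          rw [Real.exp_sum]
          exact Finset.prod_le_prod (fun p _ => by positivity) fun p _ => by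
            linarith [Real.add_one_le_exp (35 * ((p : ℕ) : ℝ) ^ (-(2 * σ₀)))]
      _ ≤ Real.exp (35 * ∑' p : Nat.Primes, ((p : ℕ) : ℝ) ^ (-(2 * σ₀))) := by
          rw [Real.exp_le_exp, ← Finset.mul_sum]
          gcongr
          exact hsumm.sum_le_tsum G fun p _ => by positivity
  have h0 : 0 ≤ ∏ p ∈ F.filter (fun p : Nat.Primes => ¬ (p : ℕ) ∣ D),
      ‖factor (χ ((p : ℕ) : ZMod D)) (((p : ℕ) : ℂ) ^ (-s))‖ :=
    Finset.prod_nonneg fun _ _ => norm_nonneg _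
  exact mul_le_mul hram hunr h0 (by positivity)

/-- **`φ♭` is bounded on `re s ≥ σ₀ > 1/2`**: `‖φ♭(s)‖ ≤ 4^{ω(D)} exp(35 ∑_p p^{-2σ₀})`
(`χ² = 1`, `D ≥ 1`). [cite: Zhang2022LandauSiegel, §3, Lemma 3.2 sketch ("φ* ≪ ∏_{p∣D} …")] -/
theorem norm_phiFlat_le [NeZero D] (hχ : χ ^ 2 = 1) {σ₀ : ℝ} (hσ₀ : 1 / 2 < σ₀) {s : ℂ}
    (hs : σ₀ ≤ s.re) :
    ‖phiFlat χ s‖ ≤ (4 : ℝ) ^ D.primeFactors.card *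
      Real.exp (35 * ∑' p : Nat.Primes, ((p : ℕ) : ℝ) ^ (-(2 * σ₀))) := by
  have hP := hasProd_factor χ hχ (s := s) (by linarith)
  have ht : Tendsto (fun F : Finset Nat.Primes =>
      ∏ p ∈ F, factor (χ ((p : ℕ) : ZMod D)) (((p : ℕ) : ℂ) ^ (-s))) atTop (𝓝 (phiFlat χ s)) := by
    simpa [HasProd] using hP
  exact le_of_tendsto' ht.norm fun F => norm_prod_factor_le χ hχ hσ₀ hs F

/-- `re p^{-s} ≥ 0` as soon as `|im s| · log p ≤ π/2` (`p ≥ 1`):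
`p^{-s} = e^{-σ log p}(cos(t log p) − i sin(t log p))`. [folklore] -/
theorem re_natCast_cpow_neg_nonneg {p : ℕ} (hp : 0 < p) {s : ℂ}
    (h : |s.im| * Real.log p ≤ π / 2) : 0 ≤ (((p : ℕ) : ℂ) ^ (-s)).re := by
  have hp0 : (0 : ℝ) < p := by exact_mod_cast hp
  have hlogp0 : 0 ≤ Real.log p := Real.log_nonneg (by exact_mod_cast hp)
  rw [Complex.cpow_def_of_ne_zero (by exact_mod_cast hp.ne'), ← Complex.ofReal_natCast,
    ← Complex.ofReal_log hp0.le, Complex.exp_re]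
  refine mul_nonneg (Real.exp_pos _).le (Real.cos_nonneg_of_mem_Icc ⟨?_, ?_⟩)
  all_goals
    have him : (((Real.log p : ℝ) : ℂ) * -s).im = -(Real.log p * s.im) := by
      rw [Complex.mul_im, Complex.ofReal_re, Complex.ofReal_im, Complex.neg_im, Complex.neg_re,
        zero_mul, add_zero, mul_neg]
    rw [him]
    have h1 : |Real.log p * s.im| ≤ π / 2 := by
      rw [abs_mul, abs_of_nonneg hlogp0, mul_comm]; exact h
    have := abs_le.1 h1
  · linarith [this.2]
  · linarith [this.1]

/-- **`φ♭` near the real axis is absolutely bounded**: if `1/2 < σ₀ ≤ re s` and `re p^{-s} ≥ 0`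
for every prime `p ∣ D` (e.g. `|im s| log D ≤ π/2`), then `‖φ♭(s)‖ ≤ exp(35 ∑_p p^{-2σ₀})` — no
dependence on `D` (ramified factors `‖(1 − p^{-s})²‖ ≤ 1 + p^{-2σ}`). This is the bound used on
the residue circle `|s − 1| = 𝓛^{-2024}` of the cell's Lemma 3.2♭ count. [folklore] -/
theorem norm_phiFlat_le_of_re_cpow_nonneg [NeZero D] (hχ : χ ^ 2 = 1) {σ₀ : ℝ} (hσ₀ : 1 / 2 < σ₀)
    {s : ℂ} (hs : σ₀ ≤ s.re)
    (hre : ∀ p : ℕ, p.Prime → p ∣ D → 0 ≤ (((p : ℕ) : ℂ) ^ (-s)).re) :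
    ‖phiFlat χ s‖ ≤ Real.exp (35 * ∑' p : Nat.Primes, ((p : ℕ) : ℝ) ^ (-(2 * σ₀))) := by
  have hsumm := summable_primes_rpow hσ₀
  have hP := hasProd_factor χ hχ (s := s) (by linarith)
  have ht : Tendsto (fun F : Finset Nat.Primes =>
      ∏ p ∈ F, factor (χ ((p : ℕ) : ZMod D)) (((p : ℕ) : ℂ) ^ (-s))) atTop (𝓝 (phiFlat χ s)) := by
    simpa [HasProd] using hP
  refine le_of_tendsto' ht.norm fun F => ?_
  have h1 : ∀ p ∈ F, ‖factor (χ ((p : ℕ) : ZMod D)) (((p : ℕ) : ℂ) ^ (-s))‖ ≤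
      1 + 35 * ((p : ℕ) : ℝ) ^ (-(2 * σ₀)) := by
    intro p _
    have hp0 : (0 : ℝ) < (p : ℕ) := by exact_mod_cast p.prop.pos
    have hz1 : ‖((p : ℕ) : ℂ) ^ (-s)‖ ≤ 1 := (norm_prime_cpow_neg_lt_one (by linarith) p).le
    have hsq : ‖((p : ℕ) : ℂ) ^ (-s)‖ ^ 2 ≤ ((p : ℕ) : ℝ) ^ (-(2 * σ₀)) := by
      rw [norm_natCast_cpow_of_pos p.prop.pos, neg_re, ← Real.rpow_natCast,
        ← Real.rpow_mul hp0.le]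
      exact Real.rpow_le_rpow_of_exponent_le (by exact_mod_cast p.prop.one_lt.le)
        (by push_cast; linarith)
    rcases apply_eq_zero_or_one_or_neg_one χ hχ ((p : ℕ) : ZMod D) with h0 | hw
    · rw [h0]
      have hpD : (p : ℕ) ∣ D := (apply_prime_eq_zero_iff χ p.prop).1 h0
      have := norm_factor_zero_le_of_re_nonneg (hre p p.prop hpD)
      have h35 : ((p : ℕ) : ℝ) ^ (-(2 * σ₀)) ≤ 35 * ((p : ℕ) : ℝ) ^ (-(2 * σ₀)) := by
        have : 0 ≤ ((p : ℕ) : ℝ) ^ (-(2 * σ₀)) := by positivity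
        linarith
      linarith
    · have hdev := norm_factor_sub_one_le_of_unit hw hz1
      calc ‖factor (χ ((p : ℕ) : ZMod D)) (((p : ℕ) : ℂ) ^ (-s))‖
          ≤ ‖(1 : ℂ)‖ + ‖factor (χ ((p : ℕ) : ZMod D)) (((p : ℕ) : ℂ) ^ (-s)) - 1‖ := by
            have := norm_add_le (1 : ℂ) (factor (χ ((p : ℕ) : ZMod D)) (((p : ℕ) : ℂ) ^ (-s)) - 1)
            rwa [add_sub_cancel] at this
        _ ≤ 1 + 35 * ((p : ℕ) : ℝ) ^ (-(2 * σ₀)) := by rw [norm_one]; linarith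
  rw [norm_prod]
  calc ∏ p ∈ F, ‖factor (χ ((p : ℕ) : ZMod D)) (((p : ℕ) : ℂ) ^ (-s))‖
      ≤ ∏ p ∈ F, (1 + 35 * ((p : ℕ) : ℝ) ^ (-(2 * σ₀))) :=
        Finset.prod_le_prod (fun _ _ => norm_nonneg _) h1
    _ ≤ Real.exp (∑ p ∈ F, 35 * ((p : ℕ) : ℝ) ^ (-(2 * σ₀))) := by
        rw [Real.exp_sum]
        exact Finset.prod_le_prod (fun p _ => by positivity) fun p _ => by
          linarith [Real.add_one_le_exp (35 * ((p : ℕ) : ℝ) ^ (-(2 * σ₀)))]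
    _ ≤ Real.exp (35 * ∑' p : Nat.Primes, ((p : ℕ) : ℝ) ^ (-(2 * σ₀))) := by
        rw [Real.exp_le_exp, ← Finset.mul_sum]
        gcongr
        exact hsumm.sum_le_tsum F fun p _ => by positivity

end Bounds

end Literature.NumberTheory.LFunctions.Zhang2022.PhiFlat

end
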